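import Mathlib
import HarnessLib
import Summits.NavierStokesRegularity.NavierStokesRegularity.Theorems.PoloidalWindowDoorPoloidalWindowRigidityZShockRiccatiTwoSided
import Literature.Geometry.Riemannian.MeanConvexFlatFrameSum

/-!
# Crux K2 `PoloidalWindowRigidity` (stmt-NavierStokesRegularity-19708), line `z_shock` — LAX'S IDENTITY ALONG A CHARACTERISTIC
# (the PDE → ODE reduction of rung R2 for the deciding stub `stub_zShockThickAut`)

`--supports stmt-NavierStokesRegularity-19708 --as helper` (leafhand-ns-poloidalwindowdoor-1 g0, 2026-08-30).  Class-free calculus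
on `ℝ × ℝ`, Mathlib only.  **No stub and no summit is closed by this file; Navier–Stokes regularity is NOT proved here.**

Rung R2 of `Cruxes/PoloidalWindowRigidity/Lines/z_shock.md` (the 1-D shadow of the deciding stub: «a two-sided eternal `C¹_b`
solution of the AUTONOMOUS genuinely nonlinear p-system is constant», Lax 1964 / John 1974 read two-sidedly) has three steps:
(1) reduce to characteristics — a Riemann invariant `r` of a diagonal `2 × 2` system `r_z + λ(r,s) r_x = 0`, `s_z + μ(r,s) s_x = 0`
is constant along its characteristic `X' = λ(r,s)`, and its transversal derivative `α := r_x` obeys LAX'S LAW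
`α' = −λ_r α² − λ_s s_x α` there, with `s_x = (d/dz)s / (λ − μ)` (John's integrating factor turns the linear term into `−h'α`);
(2) the damped two-sided Riccati lemma (tree `…ZShockRiccatiTwoSided.dampedRiccati_twoSided_eq_zero`, p793863 + append) ⇒ `α ≡ 0`;
(3) `r_x ≡ 0 ≡ s_x` ⇒ constant state.  THIS FILE is step (1), for `C²` invariants on `ℝ × ℝ` (height `z` = first coordinate,
`x` = second):

* `hasDerivAt_along` — chain rule along a curve `z ↦ (z, X z)`: `(F(z, X z))' = ∂_z F + X'·∂_x F`;
* `riemannInvariant_const_along` — `r` is constant along its characteristic;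
* `otherInvariant_deriv_along` — `(d/dz) s(z, X z) = (λ − μ)·s_x` along the `λ`-characteristic;
* `lax_riccati_along_characteristic` — `(d/dz) r_x(z, X z) = −λ_r·r_x² − (λ_s·s_x)·r_x` (Lax 1964, eq. (2.6)), from the
  `x`-derivative of the equation and the symmetry of second derivatives (`ContDiffAt.isSymmSndFDerivAt`);
* `john_factor_hasDerivAt` — John's integrating factor: with `r ≡ r₀` on the curve and `H_f' (λ − μ)(r₀,·) = λ_s(r₀,·)`, the
  function `h := H_f ∘ s(·, X ·)` has `h' = λ_s·s_x` along the curve;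
* `transversal_derivative_eq_zero_along` — ASSEMBLY with the tree's damped two-sided Riccati lemma: if along a GLOBAL (two-sided)
  characteristic `λ_r ≥ a₀ > 0` and such a bounded `h` exists, then `r_x ≡ 0` along it (steps (1)+(2) of R2 for that curve).

presearch: Lax 1964 J. Math. Phys. 5, 611–613 (eq. (2.6)); John 1974 CPAM 27, 377–405 (§2); Hörmander 1997 §4.2 — tree
`lean search 'Riemann invariant|characteristic.*Riccati'` → none. [folklore]
-/

noncomputable section

namespace Summit.NavierStokesRegularity.NavierStokesRegularity.Theorems.PoloidalWindowDoorPoloidalWindowRigidityZShockCharacteristicRiccati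

-- the problem directory repeats the summit name (`NavierStokesRegularity/NavierStokesRegularity`)
set_option linter.dupNamespace false

open Set Filter Topology Function
open Summit.NavierStokesRegularity.NavierStokesRegularity.Theorems.PoloidalWindowDoorPoloidalWindowRigidityZShockRiccatiTwoSided

/-! (the coordinate expansion `L (a, b) = a·L(1,0) + b·L(0,1)` is the tree's `Literature.Geometry.Riemannian.clm_prod_apply_eq`) -/

/-- **Chain rule along a curve.** If `F : ℝ × ℝ → ℝ` is differentiable at `(z, X z)` and `X` has derivative `X'` at `z`, then
`t ↦ F (t, X t)` has derivative `∂_z F + X'·∂_x F` at `z` (`∂_z = D(·)(1,0)`, `∂_x = D(·)(0,1)`). [folklore] -/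
theorem hasDerivAt_along {F : ℝ × ℝ → ℝ} {X : ℝ → ℝ} {X' z : ℝ} (hF : DifferentiableAt ℝ F (z, X z))
    (hX : HasDerivAt X X' z) :
    HasDerivAt (fun t => F (t, X t)) (fderiv ℝ F (z, X z) (1, 0) + X' * fderiv ℝ F (z, X z) (0, 1)) z := by
  have hγ : HasDerivAt (fun t => (t, X t)) (1, X') z := (hasDerivAt_id z).prodMk hX
  have h := hF.hasFDerivAt.comp_hasDerivAt z hγ
  have hval : fderiv ℝ F (z, X z) (1, X') = fderiv ℝ F (z, X z) (1, 0) + X' * fderiv ℝ F (z, X z) (0, 1) := by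
    rw [Literature.Geometry.Riemannian.clm_prod_apply_eq]; ring
  rw [← hval]
  exact h

/-- **A Riemann invariant is constant along its characteristic.**  If `∂_z r + λ(r,s)·∂_x r = 0` on `ℝ × ℝ` (`r` differentiable) and
`X' = λ(r,s)(z, X z)`, then `t ↦ r (t, X t)` has derivative `0` everywhere. [folklore] -/
theorem riemannInvariant_const_along {r s : ℝ × ℝ → ℝ} {Λ : ℝ × ℝ → ℝ} (hr : Differentiable ℝ r)
    (hPDE : ∀ p, fderiv ℝ r p (1, 0) + Λ (r p, s p) * fderiv ℝ r p (0, 1) = 0)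
    {X : ℝ → ℝ} (hX : ∀ z, HasDerivAt X (Λ (r (z, X z), s (z, X z))) z) (z : ℝ) :
    HasDerivAt (fun t => r (t, X t)) 0 z := by
  have h := hasDerivAt_along (hr (z, X z)) (hX z)
  rwa [hPDE] at h

/-- **The other invariant along the `λ`-characteristic.**  If `∂_z s + μ(r,s)·∂_x s = 0` and `X' = λ(r,s)(z, X z)`, then
`(d/dz) s(z, X z) = (λ − μ)·∂_x s` (John: this converts `s_x` into a derivative ALONG the curve). [folklore] -/
theorem otherInvariant_deriv_along {r s : ℝ × ℝ → ℝ} {Λ M : ℝ × ℝ → ℝ} (hs : Differentiable ℝ s)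
    (hPDEs : ∀ p, fderiv ℝ s p (1, 0) + M (r p, s p) * fderiv ℝ s p (0, 1) = 0)
    {X : ℝ → ℝ} (hX : ∀ z, HasDerivAt X (Λ (r (z, X z), s (z, X z))) z) (z : ℝ) :
    HasDerivAt (fun t => s (t, X t))
      ((Λ (r (z, X z), s (z, X z)) - M (r (z, X z), s (z, X z))) * fderiv ℝ s (z, X z) (0, 1)) z := by
  have h := hasDerivAt_along (hs (z, X z)) (hX z)
  have e : fderiv ℝ s (z, X z) (1, 0) = -(M (r (z, X z), s (z, X z)) * fderiv ℝ s (z, X z) (0, 1)) :=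
    eq_neg_of_add_eq_zero_left (hPDEs (z, X z))
  refine h.congr_deriv ?_
  rw [e]; ring

/-- **Lax's identity along a characteristic** (Lax 1964, (2.6)).  Let `r ∈ C²(ℝ × ℝ)`, `s` and `λ` differentiable, with
`∂_z r + λ(r,s)·∂_x r = 0` everywhere, and let `X` be a `λ`-characteristic, `X'(z) = λ(r,s)(z, X z)`.  Then the transversal
derivative `α(z) := ∂_x r (z, X z)` satisfies
`α' = −λ_r·α² − (λ_s·∂_x s)·α`   (`λ_r = Dλ(1,0)`, `λ_s = Dλ(0,1)` at `(r,s)(z, X z)`).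
Proof: `α' = r_xz + λ r_xx` (chain rule), `r_xz = r_zx` (symmetry of `D²r`), and the `x`-derivative of the equation gives
`r_zx + (λ_r r_x + λ_s s_x) r_x + λ r_xx = 0`. [folklore] -/
theorem lax_riccati_along_characteristic {r s : ℝ × ℝ → ℝ} {Λ : ℝ × ℝ → ℝ} (hr : ContDiff ℝ 2 r)
    (hs : Differentiable ℝ s) (hΛ : Differentiable ℝ Λ)
    (hPDE : ∀ p, fderiv ℝ r p (1, 0) + Λ (r p, s p) * fderiv ℝ r p (0, 1) = 0)
    {X : ℝ → ℝ} (hX : ∀ z, HasDerivAt X (Λ (r (z, X z), s (z, X z))) z) (z : ℝ) :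
    HasDerivAt (fun t => fderiv ℝ r (t, X t) (0, 1))
      (-(fderiv ℝ Λ (r (z, X z), s (z, X z)) (1, 0) * fderiv ℝ r (z, X z) (0, 1) ^ 2) -
        (fderiv ℝ Λ (r (z, X z), s (z, X z)) (0, 1) * fderiv ℝ s (z, X z) (0, 1)) *
          fderiv ℝ r (z, X z) (0, 1)) z := by
  have hr1 : Differentiable ℝ r := hr.differentiable (by simp)
  have hD2c : ContDiff ℝ 1 (fderiv ℝ r) := hr.fderiv_right (by norm_num)
  have hD2 : Differentiable ℝ (fderiv ℝ r) := hD2c.differentiable (by simp)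
  -- `p ↦ ∂_v r p` has derivative `u ↦ D²r p u v`
  have hdir : ∀ (v : ℝ × ℝ) (p : ℝ × ℝ),
      HasFDerivAt (fun q => fderiv ℝ r q v) ((ContinuousLinearMap.apply ℝ ℝ v).comp (fderiv ℝ (fderiv ℝ r) p)) p :=
    fun v p => (ContinuousLinearMap.apply ℝ ℝ v).hasFDerivAt.comp p (hD2 p).hasFDerivAt
  -- symmetry of the second derivative at the point of the curve
  have hsymm : fderiv ℝ (fderiv ℝ r) (z, X z) (0, 1) (1, 0) = fderiv ℝ (fderiv ℝ r) (z, X z) (1, 0) (0, 1) :=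
    (hr.contDiffAt.isSymmSndFDerivAt (by simp)) (0, 1) (1, 0)
  -- (a) the chain rule for `α`
  have hg : DifferentiableAt ℝ (fun q => fderiv ℝ r q (0, 1)) (z, X z) := (hdir (0, 1) (z, X z)).differentiableAt
  have hα := hasDerivAt_along (F := fun q => fderiv ℝ r q (0, 1)) hg (hX z)
  have hg1 : fderiv ℝ (fun q => fderiv ℝ r q (0, 1)) (z, X z) (1, 0) =
      fderiv ℝ (fderiv ℝ r) (z, X z) (1, 0) (0, 1) := by
    rw [(hdir (0, 1) (z, X z)).fderiv]; simp
  have hg2 : fderiv ℝ (fun q => fderiv ℝ r q (0, 1)) (z, X z) (0, 1) =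
      fderiv ℝ (fderiv ℝ r) (z, X z) (0, 1) (0, 1) := by
    rw [(hdir (0, 1) (z, X z)).fderiv]; simp
  -- (b) the `x`-derivative of the equation at the point of the curve
  have hcomp : HasFDerivAt (fun q => Λ (r q, s q))
      ((fderiv ℝ Λ (r (z, X z), s (z, X z))).comp ((fderiv ℝ r (z, X z)).prod (fderiv ℝ s (z, X z)))) (z, X z) :=
    (hΛ (r (z, X z), s (z, X z))).hasFDerivAt.comp (z, X z)
      ((hr1 (z, X z)).hasFDerivAt.prodMk (hs (z, X z)).hasFDerivAt)
  have hΦ : HasFDerivAt (fun q => fderiv ℝ r q (1, 0) + Λ (r q, s q) * fderiv ℝ r q (0, 1))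
      ((ContinuousLinearMap.apply ℝ ℝ (1, 0)).comp (fderiv ℝ (fderiv ℝ r) (z, X z)) +
        (Λ (r (z, X z), s (z, X z)) • (ContinuousLinearMap.apply ℝ ℝ (0, 1)).comp (fderiv ℝ (fderiv ℝ r) (z, X z)) +
          fderiv ℝ r (z, X z) (0, 1) •
            (fderiv ℝ Λ (r (z, X z), s (z, X z))).comp ((fderiv ℝ r (z, X z)).prod (fderiv ℝ s (z, X z)))))
      (z, X z) :=
    (hdir (1, 0) (z, X z)).add (hcomp.mul (hdir (0, 1) (z, X z)))
  have hΦ0 : fderiv ℝ (fun q => fderiv ℝ r q (1, 0) + Λ (r q, s q) * fderiv ℝ r q (0, 1)) (z, X z) = 0 := by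
    rw [show (fun q => fderiv ℝ r q (1, 0) + Λ (r q, s q) * fderiv ℝ r q (0, 1)) = fun _ => (0 : ℝ) from
      funext hPDE]
    exact fderiv_const_apply 0
  have hkey : fderiv ℝ (fderiv ℝ r) (z, X z) (0, 1) (1, 0) +
      (Λ (r (z, X z), s (z, X z)) * fderiv ℝ (fderiv ℝ r) (z, X z) (0, 1) (0, 1) +
        fderiv ℝ r (z, X z) (0, 1) *
          fderiv ℝ Λ (r (z, X z), s (z, X z)) (fderiv ℝ r (z, X z) (0, 1), fderiv ℝ s (z, X z) (0, 1))) = 0 := by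
    have h := congrArg (fun L : ℝ × ℝ →L[ℝ] ℝ => L (0, 1)) hΦ.fderiv
    rw [hΦ0] at h
    simpa [ContinuousLinearMap.comp_apply, ContinuousLinearMap.apply_apply] using h.symm
  -- (c) assemble
  refine hα.congr_deriv ?_
  rw [hg1, hg2, ← hsymm]
  rw [Literature.Geometry.Riemannian.clm_prod_apply_eq (fderiv ℝ Λ (r (z, X z), s (z, X z)))
    (fderiv ℝ r (z, X z) (0, 1)) (fderiv ℝ s (z, X z) (0, 1))] at hkey
  linear_combination hkey

/-- **John's integrating factor.**  Along the `λ`-characteristic `X` (where `r ≡ r₀`), if `H_f : ℝ → ℝ` satisfies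
`H_f'(σ)·(λ(r₀,σ) − μ(r₀,σ)) = λ_s(r₀,σ)` for all `σ`, then `h(z) := H_f (s (z, X z))` has derivative `λ_s·∂_x s` at every `z`
(chain rule with `otherInvariant_deriv_along`). [folklore] -/
theorem john_factor_hasDerivAt {r s : ℝ × ℝ → ℝ} {Λ M : ℝ × ℝ → ℝ} (hs : Differentiable ℝ s)
    (hPDEs : ∀ p, fderiv ℝ s p (1, 0) + M (r p, s p) * fderiv ℝ s p (0, 1) = 0)
    {X : ℝ → ℝ} (hX : ∀ z, HasDerivAt X (Λ (r (z, X z), s (z, X z))) z)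
    {r₀ : ℝ} (hr₀ : ∀ z, r (z, X z) = r₀) {Hf Hf' : ℝ → ℝ} (hHf : ∀ σ, HasDerivAt Hf (Hf' σ) σ)
    (hHf' : ∀ σ, Hf' σ * (Λ (r₀, σ) - M (r₀, σ)) = fderiv ℝ Λ (r₀, σ) (0, 1)) (z : ℝ) :
    HasDerivAt (fun t => Hf (s (t, X t)))
      (fderiv ℝ Λ (r (z, X z), s (z, X z)) (0, 1) * fderiv ℝ s (z, X z) (0, 1)) z := by
  have h := (hHf (s (z, X z))).comp z (otherInvariant_deriv_along (Λ := Λ) hs hPDEs hX z)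
  refine h.congr_deriv ?_
  rw [hr₀ z, ← hHf' (s (z, X z))]
  ring

/-- **Steps (1)+(2) of rung R2 along one global characteristic.**  Let `r ∈ C²(ℝ × ℝ)`, `s, λ` differentiable, with the diagonal
system `∂_z r + λ(r,s)·∂_x r = 0`; let `X : ℝ → ℝ` be a GLOBAL (two-sided) `λ`-characteristic.  Assume GENUINE NONLINEARITY with a
fixed sign along the curve, `λ_r ≥ a₀ > 0`, and John's integrating factor: a bounded `h` (`|h| ≤ H`) with `h' = λ_s·∂_x s` along the
curve (supplied by `john_factor_hasDerivAt` from any antiderivative of `λ_s/(λ − μ)` at fixed `r₀` and the boundedness of `s`).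
Then the transversal derivative vanishes identically along the curve: `∂_x r (z, X z) = 0` for all `z` — Lax's law
(`lax_riccati_along_characteristic`) is a damped Riccati law and the tree's `dampedRiccati_twoSided_eq_zero` applies.  For
`λ_r ≤ −a₀` use `dampedRiccati_twoSided_eq_zero_of_le_neg` in the same way. [folklore] -/
theorem transversal_derivative_eq_zero_along {r s : ℝ × ℝ → ℝ} {Λ : ℝ × ℝ → ℝ} (hr : ContDiff ℝ 2 r)
    (hs : Differentiable ℝ s) (hΛ : Differentiable ℝ Λ)
    (hPDE : ∀ p, fderiv ℝ r p (1, 0) + Λ (r p, s p) * fderiv ℝ r p (0, 1) = 0)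
    {X : ℝ → ℝ} (hX : ∀ z, HasDerivAt X (Λ (r (z, X z), s (z, X z))) z)
    {a₀ H : ℝ} (ha₀ : 0 < a₀) (hgnl : ∀ z, a₀ ≤ fderiv ℝ Λ (r (z, X z), s (z, X z)) (1, 0))
    {h h' : ℝ → ℝ} (hh : ∀ z, HasDerivAt h (h' z) z)
    (hh' : ∀ z, h' z = fderiv ℝ Λ (r (z, X z), s (z, X z)) (0, 1) * fderiv ℝ s (z, X z) (0, 1))
    (hH : ∀ z, |h z| ≤ H) :
    ∀ z, fderiv ℝ r (z, X z) (0, 1) = 0 := by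
  refine dampedRiccati_twoSided_eq_zero (α := fun t => fderiv ℝ r (t, X t) (0, 1))
    (a := fun t => fderiv ℝ Λ (r (t, X t), s (t, X t)) (1, 0)) ha₀ hgnl hH hh fun z => ?_
  have hL := lax_riccati_along_characteristic hr hs hΛ hPDE hX z
  rw [← hh' z] at hL
  exact hL

end Summit.NavierStokesRegularity.NavierStokesRegularity.Theorems.PoloidalWindowDoorPoloidalWindowRigidityZShockCharacteristicRiccati

end
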